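import Summits.KontsevichZagierPeriods.Zeta5Search.Certificates.RecordRayForms
import Summits.KontsevichZagierPeriods.Zeta5Search.Certificates.BinomialSumBounds
import Summits.KontsevichZagierPeriods.Zeta5Search.Certificates.LogEnclosuresRecord
import HarnessLib

/-!
# ζ(5) search — certificates: the growth of `Q(a·n)` on the record ray, PROVED without a recurrence — I: lower bound (certifier 2)

HONEST FRAMING: systematic search; no irrationality claim unless certified.

OUR work (Summit side). For Brown–Zudilin's record ray `a·n`, `a = (8,16,10,15,12,16,18,13)`
(arXiv:2210.03391, Sect. 11), the printed rate `lim log|Q(a·n)|/n = 85.08768883…` is one half of the Literature FACT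
`BrownZudilin2022.record_rates` (not proved in the tree; reproduced numerically by two implementations of the cell).
Here the growth of `Q(a·n) = recordQ n` (`Certificates/RecordRayForms`) is bounded ON BOTH SIDES by tree theorems only,
with NO recurrence (the minimal recurrence of `Q(a·n)` has order 3 and degree 326 — gen-2 g3, not replayable) and no
analysis beyond Stirling's formula (`Literature…LogChooseStirling`) and the certified logarithms of
`Certificates/LogEnclosures{,Record}`:

* `abs_recordQ_ge` — for every `n ≥ 1`: `log|Q(a·n)| ≥ n·E − (7/2)·log(30n) − 14`, `E = growthEnt` = the entropy of the
  single lattice term `(k₁,k₂) = (24n, 23n)` of (17); `growthEnt_ge` : `E ≥ 85.0519`;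
* `abs_recordQ_le` — for every `n`: `|Q(a·n)| ≤ (15n+1)(8n+1)·exp(n·A₀)`, `A₀ = growthSup` = the value of the Chernoff
  (tangent-plane) bound at the rational slopes `t₁,…,t₇` below, chosen `10⁻⁵`-close to the maximiser
  `(k₁,k₂)/n = (x*, y*) = (24.1294931…, 23.2542144…)` (`x*` = the root of the cubic `RecordFamilyCertificates.C`) with the
  two stationarity relations EXACT (`slope_rel₁`, `slope_rel₂`), so that the bound does not depend on `(k₁,k₂)`;
  `growthSup_le` : `A₀ ≤ 85.08768884` (the true supremum of the entropy is `85.0876888342…`; `A₀ − sup = 2.3·10⁻⁹`);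
* RATES: `eventually_exp_le_abs_recordQ` (`∀ ε>0, ∀ᶠ n, e^{(85.0519−ε)n} ≤ |Q(a·n)|`) and
  `eventually_abs_recordQ_le_exp` (`∀ ε>0, ∀ᶠ n, |Q(a·n)| ≤ e^{(85.08768884+ε)n}`);
* `record_rates_Q_le` — consequently the limit `c` asserted by the fact `record_rates` satisfies `c ≤ 85.08768884`,
  i.e. the UPPER end of the printed bracket `(85.08768883, 85.08768884)` is now a theorem about the actual sequence; the
  lower end to the same digits needs the lattice point `(⌊x*n⌋, ⌊y*n⌋)` instead of `(24n, 23n)` (routine, not done here: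
  the integer point costs `0.0358` nats).

THIS FILE: (17) on the ray, the lattice term, `growthEnt_ge`, `abs_recordQ_pos`, `abs_recordQ_ge`. The upper bound, the
rates and the comparison with the fact are in `Certificates/RecordRayGrowthUpper.lean` (400-line rule).

Method (CERTIFY-HOWTO §9): `Q(a·n)` is `±` a sum of `(15n+1)(8n+1)` non-negative products of seven binomials
(`BinomialSum.abs_Qcoeff_eq_sum`); lower bound = one term + Stirling; upper bound = number of terms × Chernoff bound
`C(m,k) ≤ t^{−k}(1−t)^{−(m−k)}` with fixed slopes (the tangent plane of the concave entropy). Numbers, not adjectives: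
all constants are kernel-checked rationals.
-/

noncomputable section

open Finset Real Filter

namespace Summit.KontsevichZagierPeriods.Zeta5Search.RecordRay

open Summit.KontsevichZagierPeriods.Zeta5Search.BinomialSum
open Summit.KontsevichZagierPeriods.Zeta5Search.LogEnclosures
open Literature.NumberTheory.Irrationality.BrownZudilin2022 (zchoose Qcoeff QOf pOf qOf recordVec)

/-! ### (17) on the ray -/

/-- The scaled record parameter vector `p(a·n)`. -/
def pRec (n : ℕ) : Fin 7 → ℤ := ![15 * n, 14 * n, 16 * n, 29 * n, 18 * n, 13 * n, 12 * n]

/-- The scaled record parameter vector `q(a·n)`. -/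
def qRec (n : ℕ) : Fin 5 → ℤ := ![15 * n, 12 * n, 10 * n, 8 * n, 16 * n]

/-- `p(a·n) = n·(15,14,16,29,18,13,12)`. -/
theorem pOf_aRec (n : ℕ) : pOf (aRec n) = pRec n := by
  ext i; fin_cases i <;> simp [pOf, aRec, recordVec, pRec] <;> ring

/-- `q(a·n) = n·(15,12,10,8,16)`. -/
theorem qOf_aRec (n : ℕ) : qOf (aRec n) = qRec n := by
  ext i; fin_cases i <;> simp [qOf, aRec, recordVec, qRec] <;> ring

/-- `Q(a·n) = Q(p(a·n); q(a·n))`. -/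
theorem recordQ_eq_Qcoeff (n : ℕ) : recordQ n = Qcoeff (pRec n) (qRec n) := by
  unfold recordQ QOf; rw [pOf_aRec, qOf_aRec]

/-- `p(a·n)_0 = 15n`. -/
@[simp] theorem pRec_0 (n : ℕ) : pRec n 0 = 15 * n := rfl
/-- `p(a·n)_1 = 14n`. -/
@[simp] theorem pRec_1 (n : ℕ) : pRec n 1 = 14 * n := rfl
/-- `p(a·n)_2 = 16n`. -/
@[simp] theorem pRec_2 (n : ℕ) : pRec n 2 = 16 * n := rfl
/-- `p(a·n)_3 = 29n`. -/
@[simp] theorem pRec_3 (n : ℕ) : pRec n 3 = 29 * n := rfl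
/-- `p(a·n)_4 = 18n`. -/
@[simp] theorem pRec_4 (n : ℕ) : pRec n 4 = 18 * n := rfl
/-- `p(a·n)_5 = 13n`. -/
@[simp] theorem pRec_5 (n : ℕ) : pRec n 5 = 13 * n := rfl
/-- `p(a·n)_6 = 12n`. -/
@[simp] theorem pRec_6 (n : ℕ) : pRec n 6 = 12 * n := rfl
/-- `q(a·n)_0 = 15n`. -/
@[simp] theorem qRec_0 (n : ℕ) : qRec n 0 = 15 * n := rfl
/-- `q(a·n)_1 = 12n`. -/
@[simp] theorem qRec_1 (n : ℕ) : qRec n 1 = 12 * n := rfl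
/-- `q(a·n)_2 = 10n`. -/
@[simp] theorem qRec_2 (n : ℕ) : qRec n 2 = 10 * n := rfl
/-- `q(a·n)_3 = 8n`. -/
@[simp] theorem qRec_3 (n : ℕ) : qRec n 3 = 8 * n := rfl
/-- `q(a·n)_4 = 16n`. -/
@[simp] theorem qRec_4 (n : ℕ) : qRec n 4 = 16 * n := rfl

/-! ### Lower bound: the lattice term `(24n, 23n)` -/

/-- The `(24n,23n)`-term of (17) on the ray is `C(24n,15n)C(23n,12n)C(30n,12n)C(15n,10n)C(12n,8n)C(8n,5n)C(16n,10n)`. -/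
theorem latticeTerm_eq (n : ℕ) :
    qTerm (pRec n) (qRec n) (24 * n) (23 * n) =
      ((24 * n).choose (15 * n) : ℤ) * ((23 * n).choose (12 * n) : ℤ) * ((30 * n).choose (12 * n) : ℤ)
        * ((15 * n).choose (10 * n) : ℤ) * ((12 * n).choose (8 * n) : ℤ) * ((8 * n).choose (5 * n) : ℤ)
        * ((16 * n).choose (10 * n) : ℤ) := by
  unfold qTerm
  simp only [pRec_0, pRec_1, pRec_2, pRec_3, pRec_4, pRec_5, pRec_6, qRec_0, qRec_1, qRec_2, qRec_3, qRec_4]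
  rw [zchoose_cast_eq (n := 24 * n) (k := 15 * n) (by push_cast; ring) (by push_cast; ring) (by omega),
    zchoose_cast_eq (n := 23 * n) (k := 12 * n) (by push_cast; ring) (by push_cast; ring) (by omega),
    zchoose_cast_eq (n := 30 * n) (k := 12 * n) (by push_cast; ring) (by push_cast; ring) (by omega),
    zchoose_cast_eq (n := 15 * n) (k := 10 * n) (by push_cast; ring) (by push_cast; ring) (by omega),
    zchoose_cast_eq (n := 12 * n) (k := 8 * n) (by push_cast; ring) (by push_cast; ring) (by omega),
    zchoose_cast_eq (n := 8 * n) (k := 5 * n) (by push_cast; ring) (by push_cast; ring) (by omega),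
    zchoose_cast_eq (n := 16 * n) (k := 10 * n) (by push_cast; ring) (by push_cast; ring) (by omega)]

/-- The entropy of the lattice term per step `n`:
`E = Σ_{(α,β)} (α log α − β log β − (α−β) log(α−β))` over `(24,15),(23,12),(30,12),(15,10),(12,8),(8,5),(16,10)`
(`= 90 log 2 − 21 log 3 − 11 log 11 + 23 log 23 = 85.05190715…`). -/
def growthEnt : ℝ :=
  (24 * Real.log 24 - 15 * Real.log 15 - (24 - 15) * Real.log (24 - 15))
  + (23 * Real.log 23 - 12 * Real.log 12 - (23 - 12) * Real.log (23 - 12))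
  + (30 * Real.log 30 - 12 * Real.log 12 - (30 - 12) * Real.log (30 - 12))
  + (15 * Real.log 15 - 10 * Real.log 10 - (15 - 10) * Real.log (15 - 10))
  + (12 * Real.log 12 - 8 * Real.log 8 - (12 - 8) * Real.log (12 - 8))
  + (8 * Real.log 8 - 5 * Real.log 5 - (8 - 5) * Real.log (8 - 5))
  + (16 * Real.log 16 - 10 * Real.log 10 - (16 - 10) * Real.log (16 - 10))

/-- **`E ≥ 85.0519`** (certified logarithms). -/
theorem growthEnt_ge : (850519 / 10 ^ 4 : ℝ) ≤ growthEnt := by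
  unfold growthEnt
  norm_num only
  obtain ⟨a1, a2⟩ := log_24_bounds
  obtain ⟨b1, b2⟩ := log_15_bounds
  obtain ⟨c1, c2⟩ := log_9_bounds
  obtain ⟨d1, d2⟩ := log_23_bounds
  obtain ⟨e1, e2⟩ := log_12_bounds
  obtain ⟨f1, f2⟩ := log_11_bounds
  obtain ⟨g1, g2⟩ := log_30_bounds
  obtain ⟨h1, h2⟩ := log_18_bounds
  obtain ⟨i1, i2⟩ := log_10_bounds
  obtain ⟨j1, j2⟩ := log_five_bounds
  obtain ⟨k1, k2⟩ := log_8_bounds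
  obtain ⟨l1, l2⟩ := log_4_bounds
  obtain ⟨m1, m2⟩ := log_three_bounds
  obtain ⟨o1, o2⟩ := log_16_bounds
  obtain ⟨p1, p2⟩ := log_6_bounds
  linarith

/-- The lattice term is positive. -/
theorem latticeTerm_pos (n : ℕ) : (0 : ℝ) < (qTerm (pRec n) (qRec n) (24 * n) (23 * n) : ℝ) := by
  rw [latticeTerm_eq]; push_cast
  have c1 : (0 : ℝ) < ((24 * n).choose (15 * n) : ℝ) := by exact_mod_cast Nat.choose_pos (by omega)
  have c2 : (0 : ℝ) < ((23 * n).choose (12 * n) : ℝ) := by exact_mod_cast Nat.choose_pos (by omega)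
  have c3 : (0 : ℝ) < ((30 * n).choose (12 * n) : ℝ) := by exact_mod_cast Nat.choose_pos (by omega)
  have c4 : (0 : ℝ) < ((15 * n).choose (10 * n) : ℝ) := by exact_mod_cast Nat.choose_pos (by omega)
  have c5 : (0 : ℝ) < ((12 * n).choose (8 * n) : ℝ) := by exact_mod_cast Nat.choose_pos (by omega)
  have c6 : (0 : ℝ) < ((8 * n).choose (5 * n) : ℝ) := by exact_mod_cast Nat.choose_pos (by omega)
  have c7 : (0 : ℝ) < ((16 * n).choose (10 * n) : ℝ) := by exact_mod_cast Nat.choose_pos (by omega)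
  exact mul_pos (mul_pos (mul_pos (mul_pos (mul_pos (mul_pos c1 c2) c3) c4) c5) c6) c7

/-- `Q(a·n) ≠ 0` for every `n` (indeed `|Q(a·n)| ≥` the lattice term `> 0`). -/
theorem abs_recordQ_pos (n : ℕ) : (0 : ℝ) < |(recordQ n : ℝ)| := by
  have hk₁ : (24 * n : ℤ) ∈ Icc (pRec n 1) (pRec n 1 + qRec n 0) := by
    rw [mem_Icc, pRec_1, qRec_0]; constructor <;> linarith
  have hk₂ : (23 * n : ℤ) ∈ Icc (pRec n 4) (pRec n 4 + qRec n 3) := by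
    rw [mem_Icc, pRec_4, qRec_3]; constructor <;> linarith
  have hle := qTerm_le_abs_Qcoeff (pRec n) (qRec n) hk₁ hk₂
  rw [← recordQ_eq_Qcoeff] at hle
  exact (latticeTerm_pos n).trans_le hle

/-- The sum of the seven Stirling lower bounds at the lattice point, per factor. -/
def latticeStirling (n : ℕ) : ℝ :=
  ((n : ℝ) * (24 * Real.log 24 - 15 * Real.log 15 - (24 - 15) * Real.log (24 - 15)) - Real.log (24 * n) / 2 - 2)
  + ((n : ℝ) * (23 * Real.log 23 - 12 * Real.log 12 - (23 - 12) * Real.log (23 - 12)) - Real.log (23 * n) / 2 - 2)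
  + ((n : ℝ) * (30 * Real.log 30 - 12 * Real.log 12 - (30 - 12) * Real.log (30 - 12)) - Real.log (30 * n) / 2 - 2)
  + ((n : ℝ) * (15 * Real.log 15 - 10 * Real.log 10 - (15 - 10) * Real.log (15 - 10)) - Real.log (15 * n) / 2 - 2)
  + ((n : ℝ) * (12 * Real.log 12 - 8 * Real.log 8 - (12 - 8) * Real.log (12 - 8)) - Real.log (12 * n) / 2 - 2)
  + ((n : ℝ) * (8 * Real.log 8 - 5 * Real.log 5 - (8 - 5) * Real.log (8 - 5)) - Real.log (8 * n) / 2 - 2)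
  + ((n : ℝ) * (16 * Real.log 16 - 10 * Real.log 10 - (16 - 10) * Real.log (16 - 10)) - Real.log (16 * n) / 2 - 2)

/-- Replacing every `log(αᵢ n)` by `log(30 n)`: `n·E − (7/2)·log(30n) − 14 ≤ latticeStirling n`. -/
theorem latticeStirling_ge {n : ℕ} (hn : 1 ≤ n) :
    (n : ℝ) * growthEnt - 7 / 2 * Real.log (30 * n) - 14 ≤ latticeStirling n := by
  have hn' : (1 : ℝ) ≤ n := by exact_mod_cast hn
  have m1 : Real.log (24 * n) ≤ Real.log (30 * n) := Real.log_le_log (by positivity) (by linarith)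
  have m2 : Real.log (23 * n) ≤ Real.log (30 * n) := Real.log_le_log (by positivity) (by linarith)
  have m4 : Real.log (15 * n) ≤ Real.log (30 * n) := Real.log_le_log (by positivity) (by linarith)
  have m5 : Real.log (12 * n) ≤ Real.log (30 * n) := Real.log_le_log (by positivity) (by linarith)
  have m6 : Real.log (8 * n) ≤ Real.log (30 * n) := Real.log_le_log (by positivity) (by linarith)
  have m7 : Real.log (16 * n) ≤ Real.log (30 * n) := Real.log_le_log (by positivity) (by linarith)
  have hE : latticeStirling n = (n : ℝ) * growthEnt - (Real.log (24 * n) + Real.log (23 * n) + Real.log (30 * n)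
      + Real.log (15 * n) + Real.log (12 * n) + Real.log (8 * n) + Real.log (16 * n)) / 2 - 14 := by
    unfold latticeStirling growthEnt; ring
  rw [hE]
  linarith

/-- Stirling for the seven factors: `exp(latticeStirling n) ≤` the lattice term. -/
theorem exp_le_latticeTerm {n : ℕ} (hn : 1 ≤ n) :
    Real.exp (latticeStirling n) ≤ (qTerm (pRec n) (qRec n) (24 * n) (23 * n) : ℝ) := by
  rw [latticeTerm_eq]; push_cast
  have s1 := log_choose_ge_scaled (α := 24) (β := 15) (by norm_num) (by norm_num) hn
  have s2 := log_choose_ge_scaled (α := 23) (β := 12) (by norm_num) (by norm_num) hn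
  have s3 := log_choose_ge_scaled (α := 30) (β := 12) (by norm_num) (by norm_num) hn
  have s4 := log_choose_ge_scaled (α := 15) (β := 10) (by norm_num) (by norm_num) hn
  have s5 := log_choose_ge_scaled (α := 12) (β := 8) (by norm_num) (by norm_num) hn
  have s6 := log_choose_ge_scaled (α := 8) (β := 5) (by norm_num) (by norm_num) hn
  have s7 := log_choose_ge_scaled (α := 16) (β := 10) (by norm_num) (by norm_num) hn
  push_cast at s1 s2 s3 s4 s5 s6 s7
  have c1 : (0 : ℝ) < ((24 * n).choose (15 * n) : ℝ) := by exact_mod_cast Nat.choose_pos (by omega)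
  have c2 : (0 : ℝ) < ((23 * n).choose (12 * n) : ℝ) := by exact_mod_cast Nat.choose_pos (by omega)
  have c3 : (0 : ℝ) < ((30 * n).choose (12 * n) : ℝ) := by exact_mod_cast Nat.choose_pos (by omega)
  have c4 : (0 : ℝ) < ((15 * n).choose (10 * n) : ℝ) := by exact_mod_cast Nat.choose_pos (by omega)
  have c5 : (0 : ℝ) < ((12 * n).choose (8 * n) : ℝ) := by exact_mod_cast Nat.choose_pos (by omega)
  have c6 : (0 : ℝ) < ((8 * n).choose (5 * n) : ℝ) := by exact_mod_cast Nat.choose_pos (by omega)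
  have c7 : (0 : ℝ) < ((16 * n).choose (10 * n) : ℝ) := by exact_mod_cast Nat.choose_pos (by omega)
  have hprod := prod7_le (Real.exp_nonneg _) (Real.exp_nonneg _) (Real.exp_nonneg _) (Real.exp_nonneg _)
    (Real.exp_nonneg _) (Real.exp_nonneg _) (Real.exp_nonneg _)
    ((Real.le_log_iff_exp_le c1).1 s1) ((Real.le_log_iff_exp_le c2).1 s2) ((Real.le_log_iff_exp_le c3).1 s3)
    ((Real.le_log_iff_exp_le c4).1 s4) ((Real.le_log_iff_exp_le c5).1 s5) ((Real.le_log_iff_exp_le c6).1 s6)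
    ((Real.le_log_iff_exp_le c7).1 s7)
  refine le_trans (le_of_eq ?_) hprod
  simp only [← Real.exp_add]
  rfl

/-- **Lower bound for every `n ≥ 1`**: `n·E − (7/2)·log(30n) − 14 ≤ log|Q(a·n)|`. -/
theorem abs_recordQ_ge {n : ℕ} (hn : 1 ≤ n) :
    (n : ℝ) * growthEnt - 7 / 2 * Real.log (30 * n) - 14 ≤ Real.log |(recordQ n : ℝ)| := by
  have hk₁ : (24 * n : ℤ) ∈ Icc (pRec n 1) (pRec n 1 + qRec n 0) := by
    rw [mem_Icc, pRec_1, qRec_0]; constructor <;> linarith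
  have hk₂ : (23 * n : ℤ) ∈ Icc (pRec n 4) (pRec n 4 + qRec n 3) := by
    rw [mem_Icc, pRec_4, qRec_3]; constructor <;> linarith
  have hle := qTerm_le_abs_Qcoeff (pRec n) (qRec n) hk₁ hk₂
  rw [← recordQ_eq_Qcoeff] at hle
  have h := (Real.le_log_iff_exp_le (abs_recordQ_pos n)).2 ((exp_le_latticeTerm hn).trans hle)
  exact (latticeStirling_ge hn).trans h

end Summit.KontsevichZagierPeriods.Zeta5Search.RecordRay
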